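import Summits.Parity.GeneralizedHardyLittlewood.Theorems.PrimeLevelFamEdgeMomentsBeyondDiagonalDiagCornerAbelFinal
import Summits.Parity.GeneralizedHardyLittlewood.Theorems.PrimeLevelFamEdgeMomentsBeyondDiagonalDiagBoseMixedRemainderId
import Summits.Parity.GeneralizedHardyLittlewood.Theorems.PrimeLevelFamEdgeMomentsBeyondDiagonalDiagBoseMixedTailRem
import HarnessLib

/-!
# Route `PrimeLevelFamEdge`, crux K_A `MomentsBeyondDiagonal` (stmt-Parity-20007), line «petersson_layers» v4, stub `stub_diag`:
# **the two-variable Abel estimate for the continued Bose remainder `r_ab` (census R2 ⟶ corner of the general-`Q` diagonal)**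

Plugging the four structural bounds of the continued Bose remainder
`r_ab(y) = c_ab(y) − (c_ab(1) + A_ab + Π_ab(y))` (`…DiagBoseMixedRemainderId`: (S1),(S2) on `(0,1]`;
`…DiagBoseMixedTailRem`: (T1),(T2) on `[1,∞)`) into `…DiagCornerAbelFinal.abs_doubleSum_sqrt_log_weight_le`:

* `abs_doubleSum_bose_rem_le` — **for every `(a,b)` there is ONE constant `C₀` such that for all admissible
  `Y, α, B, η, K₁, i, j` (`2αK₁Y ≤ 1`):
  `|Σ_{k₁,k₂≤Y} a(k₁)a(k₂)ℓ⁺(k₁)ⁱℓ⁺(k₂)ʲ r_ab(αk₁k₂)| ≤ Sᵢ·B·logʲY·3C₀√(2αK₁Y) + Sⱼ·2η·logⁱY·(3(C₀+C₀P)+2C₀+C₀P(1+|log M|))`**,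
  `P = (1+|log M|)^{a+b+1}`, `M = 2αY²` — the general-`Q` replacement for K_B's `abs_doubleSum_cornerE_pow_le`.

What is left of the corner for `stub_diag` is the Σ_cΣ_d μ(d) bookkeeping of `…DiagCornerProfileSum/CornerProfile` type.

Def-free; theorems only. Helper `--supports stmt-Parity-20007`; closes nothing; K_A, K_B and the Parity summit are NOT
proved; nothing about Landau–Siegel zeros.

## References
* E. Kowalski, P. Michel, J. VanderKam, J. reine angew. Math. 526 (2000), (22)–(28) pp. 12–15 and Prop. 5.1 p. 18.
  [cite: KowalskiMichelVanderKam2000, Prop. 5.1 — derivation (corner of the diagonal, general Q)]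
-/

noncomputable section

open Real Set MeasureTheory Finset

namespace Summit.Parity.GeneralizedHardyLittlewood.Theorems.MomentsBeyondDiagonal.DiagCorner

open Summit.Parity.GeneralizedHardyLittlewood.Theorems.BeyondDiagonalBeatsQuarter.Corner
open Summit.Parity.GeneralizedHardyLittlewood.Theorems.MomentsBeyondDiagonal.DiagLines

/-- **Two-variable Abel estimate for the continued Bose remainder `r_ab`.**
[cite: KowalskiMichelVanderKam2000, Prop. 5.1 — derivation (corner of the diagonal, general Q, remainder of the weight)] -/
theorem abs_doubleSum_bose_rem_le (a b : ℕ) : ∃ C₀ : ℝ, 0 ≤ C₀ ∧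
    ∀ (s : ℕ → ℝ) (Y α B η : ℝ) (K₁ i j : ℕ), 1 ≤ Y → 0 < α → 1 ≤ i → 1 ≤ j →
      (∀ e : ℕ, |∑ k ∈ Icc 1 e, s k| ≤ B) → (∀ e : ℕ, K₁ ≤ e → |∑ k ∈ Icc 1 e, s k| ≤ η) →
      2 * α * K₁ * Y ≤ 1 →
    |∑ k₁ ∈ Icc 1 ⌊Y⌋₊, ∑ k₂ ∈ Icc 1 ⌊Y⌋₊,
        s k₁ * s k₂ * ellp Y k₁ ^ i * ellp Y k₂ ^ j *
          ((∫ u₁ in Ioi (0 : ℝ), Real.log u₁ ^ a *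
              ∫ u₂ in Ioi ((α * k₁ * k₂) / u₁), Real.exp (-(u₁ + u₂)) / (1 - Real.exp (-(u₁ + u₂))) ^ 2 *
                Real.log u₂ ^ b) -
            ((∫ u₁ in Ioi (0 : ℝ), Real.log u₁ ^ a *
                ∫ u₂ in Ioi (1 / u₁), Real.exp (-(u₁ + u₂)) / (1 - Real.exp (-(u₁ + u₂))) ^ 2 * Real.log u₂ ^ b) +
              (∫ η in Ioc (0 : ℝ) 1, (η * (∫ u in Ioi (0 : ℝ), Real.log u ^ a * Real.log (η / u) ^ b *
                  (Real.exp (-(u + η / u)) / (1 - Real.exp (-(u + η / u))) ^ 2) / u) -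
                ∫ v in Ioc (0 : ℝ) 1, ((-(Real.log (1 / η) / 2) + Real.log v) ^ a *
                    (-(Real.log (1 / η) / 2) - Real.log v) ^ b +
                  (-(Real.log (1 / η) / 2) - Real.log v) ^ a * (-(Real.log (1 / η) / 2) + Real.log v) ^ b) *
                  (v / (1 + v ^ 2) ^ 2)) / η) +
              ∑ i' ∈ Finset.range (a + 1), ∑ j' ∈ Finset.range (b + 1),
                (a.choose i' : ℝ) * (b.choose j' : ℝ) * ((-1) ^ j' + (-1) ^ i') *
                  (∫ v in Ioc (0 : ℝ) 1, Real.log v ^ (i' + j') * (v / (1 + v ^ 2) ^ 2)) *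
                  ((-1 / 2 : ℝ) ^ (a - i' + (b - j')) * Real.log (1 / (α * k₁ * k₂)) ^ (a - i' + (b - j') + 1) /
                    (((a - i' + (b - j') : ℕ) : ℝ) + 1))))| ≤
      (∑ k ∈ Icc 1 ⌊Y⌋₊, |s k| * ellp Y k ^ i) *
          (B * (Real.log Y ^ j * (3 * C₀ * Real.sqrt (2 * α * K₁ * Y)))) +
        (∑ k ∈ Icc 1 ⌊Y⌋₊, |s k| * ellp Y k ^ j) * ((2 * η) * (Real.log Y ^ i *
          (3 * (C₀ + C₀ * (1 + |Real.log (2 * α * Y ^ 2)|) ^ (a + b + 1)) + 2 * C₀ +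
            C₀ * (1 + |Real.log (2 * α * Y ^ 2)|) ^ (a + b + 1) * (1 + |Real.log (2 * α * Y ^ 2)|)))) := by
  obtain ⟨C₁, hC₁⟩ := abs_bose_rem_small_le_sqrt a b
  obtain ⟨C₂, hC₂⟩ := abs_bose_rem_small_sub_le_sqrt a b
  obtain ⟨C₃, hC₃⟩ := abs_bose_rem_tail_le a b
  obtain ⟨C₄, hC₄⟩ := abs_bose_rem_tail_sub_le a b
  set C₀ : ℝ := max (max |C₁| |C₂|) (max |C₃| |C₄|) with hC₀
  have h1 : C₁ ≤ C₀ := (le_abs_self _).trans ((le_max_left _ _).trans (le_max_left _ _))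
  have h2 : C₂ ≤ C₀ := (le_abs_self _).trans ((le_max_right _ _).trans (le_max_left _ _))
  have h3 : C₃ ≤ C₀ := (le_abs_self _).trans ((le_max_left _ _).trans (le_max_right _ _))
  have h4 : C₄ ≤ C₀ := (le_abs_self _).trans ((le_max_right _ _).trans (le_max_right _ _))
  have hC₀0 : 0 ≤ C₀ := (abs_nonneg C₁).trans ((le_max_left _ _).trans (le_max_left _ _))
  refine ⟨C₀, hC₀0, fun s Y α B η K₁ i j hY hα hi hj hB hη hY₁ ↦ ?_⟩
  -- the weight as a function of `y`
  set r : ℝ → ℝ := fun y ↦ (∫ u₁ in Ioi (0 : ℝ), Real.log u₁ ^ a *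
      ∫ u₂ in Ioi (y / u₁), Real.exp (-(u₁ + u₂)) / (1 - Real.exp (-(u₁ + u₂))) ^ 2 * Real.log u₂ ^ b) -
    ((∫ u₁ in Ioi (0 : ℝ), Real.log u₁ ^ a *
        ∫ u₂ in Ioi (1 / u₁), Real.exp (-(u₁ + u₂)) / (1 - Real.exp (-(u₁ + u₂))) ^ 2 * Real.log u₂ ^ b) +
      (∫ η in Ioc (0 : ℝ) 1, (η * (∫ u in Ioi (0 : ℝ), Real.log u ^ a * Real.log (η / u) ^ b *
          (Real.exp (-(u + η / u)) / (1 - Real.exp (-(u + η / u))) ^ 2) / u) -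
        ∫ v in Ioc (0 : ℝ) 1, ((-(Real.log (1 / η) / 2) + Real.log v) ^ a *
            (-(Real.log (1 / η) / 2) - Real.log v) ^ b +
          (-(Real.log (1 / η) / 2) - Real.log v) ^ a * (-(Real.log (1 / η) / 2) + Real.log v) ^ b) *
          (v / (1 + v ^ 2) ^ 2)) / η) +
      ∑ i' ∈ Finset.range (a + 1), ∑ j' ∈ Finset.range (b + 1),
        (a.choose i' : ℝ) * (b.choose j' : ℝ) * ((-1) ^ j' + (-1) ^ i') *
          (∫ v in Ioc (0 : ℝ) 1, Real.log v ^ (i' + j') * (v / (1 + v ^ 2) ^ 2)) *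
          ((-1 / 2 : ℝ) ^ (a - i' + (b - j')) * Real.log (1 / y) ^ (a - i' + (b - j') + 1) /
            (((a - i' + (b - j') : ℕ) : ℝ) + 1))) with hr
  have hS1 : ∀ y : ℝ, 0 < y → y ≤ 1 → |r y| ≤ C₀ * Real.sqrt y := by
    intro y hy0 hy1
    have h := hC₁ y hy0 hy1
    simp only [hr]
    exact h.trans (by gcongr)
  have hS2 : ∀ y₁ y₂ : ℝ, 0 < y₁ → y₁ ≤ y₂ → y₂ ≤ 1 → |r y₁ - r y₂| ≤ C₀ * (y₂ - y₁) / Real.sqrt y₁ := by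
    intro y₁ y₂ hy₁ h12 hy₂
    have h := hC₂ y₁ y₂ hy₁ h12 hy₂
    have heq : r y₁ - r y₂ = ((∫ u₁ in Ioi (0 : ℝ), Real.log u₁ ^ a *
        ∫ u₂ in Ioi (y₁ / u₁), Real.exp (-(u₁ + u₂)) / (1 - Real.exp (-(u₁ + u₂))) ^ 2 * Real.log u₂ ^ b) -
      (∫ u₁ in Ioi (0 : ℝ), Real.log u₁ ^ a *
        ∫ u₂ in Ioi (y₂ / u₁), Real.exp (-(u₁ + u₂)) / (1 - Real.exp (-(u₁ + u₂))) ^ 2 * Real.log u₂ ^ b)) -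
      ((∑ i' ∈ Finset.range (a + 1), ∑ j' ∈ Finset.range (b + 1),
        (a.choose i' : ℝ) * (b.choose j' : ℝ) * ((-1) ^ j' + (-1) ^ i') *
          (∫ v in Ioc (0 : ℝ) 1, Real.log v ^ (i' + j') * (v / (1 + v ^ 2) ^ 2)) *
          ((-1 / 2 : ℝ) ^ (a - i' + (b - j')) * Real.log (1 / y₁) ^ (a - i' + (b - j') + 1) /
            (((a - i' + (b - j') : ℕ) : ℝ) + 1))) -
      ∑ i' ∈ Finset.range (a + 1), ∑ j' ∈ Finset.range (b + 1),
        (a.choose i' : ℝ) * (b.choose j' : ℝ) * ((-1) ^ j' + (-1) ^ i') *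
          (∫ v in Ioc (0 : ℝ) 1, Real.log v ^ (i' + j') * (v / (1 + v ^ 2) ^ 2)) *
          ((-1 / 2 : ℝ) ^ (a - i' + (b - j')) * Real.log (1 / y₂) ^ (a - i' + (b - j') + 1) /
            (((a - i' + (b - j') : ℕ) : ℝ) + 1))) := by
      simp only [hr]; ring
    rw [heq]
    have hs0 : 0 < Real.sqrt y₁ := Real.sqrt_pos.2 hy₁
    have hnn : 0 ≤ (y₂ - y₁) / Real.sqrt y₁ := div_nonneg (by linarith) hs0.le
    calc _ ≤ C₂ * (y₂ - y₁) / Real.sqrt y₁ := h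
      _ = C₂ * ((y₂ - y₁) / Real.sqrt y₁) := by ring
      _ ≤ C₀ * ((y₂ - y₁) / Real.sqrt y₁) := mul_le_mul_of_nonneg_right h2 hnn
      _ = _ := by ring
  have hT1 : ∀ y : ℝ, 1 ≤ y → |r y| ≤ C₀ * (1 + Real.log y) ^ (a + b + 1) := by
    intro y hy
    have h := hC₃ y hy
    simp only [hr]
    have : 0 ≤ (1 + Real.log y) ^ (a + b + 1) := pow_nonneg (by linarith [Real.log_nonneg hy]) _
    exact h.trans (by gcongr)
  have hT2 : ∀ y₁ y₂ : ℝ, 1 ≤ y₁ → y₁ ≤ y₂ → |r y₁ - r y₂| ≤ C₀ * (1 + Real.log y₂) ^ (a + b + 1) * (y₂ - y₁) / y₁ := by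
    intro y₁ y₂ hy₁ h12
    have h := hC₄ y₁ y₂ hy₁ h12
    have heq : r y₁ - r y₂ = ((∫ u₁ in Ioi (0 : ℝ), Real.log u₁ ^ a *
        ∫ u₂ in Ioi (y₁ / u₁), Real.exp (-(u₁ + u₂)) / (1 - Real.exp (-(u₁ + u₂))) ^ 2 * Real.log u₂ ^ b) -
      (∫ u₁ in Ioi (0 : ℝ), Real.log u₁ ^ a *
        ∫ u₂ in Ioi (y₂ / u₁), Real.exp (-(u₁ + u₂)) / (1 - Real.exp (-(u₁ + u₂))) ^ 2 * Real.log u₂ ^ b)) -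
      ((∑ i' ∈ Finset.range (a + 1), ∑ j' ∈ Finset.range (b + 1),
        (a.choose i' : ℝ) * (b.choose j' : ℝ) * ((-1) ^ j' + (-1) ^ i') *
          (∫ v in Ioc (0 : ℝ) 1, Real.log v ^ (i' + j') * (v / (1 + v ^ 2) ^ 2)) *
          ((-1 / 2 : ℝ) ^ (a - i' + (b - j')) * Real.log (1 / y₁) ^ (a - i' + (b - j') + 1) /
            (((a - i' + (b - j') : ℕ) : ℝ) + 1))) -
      ∑ i' ∈ Finset.range (a + 1), ∑ j' ∈ Finset.range (b + 1),
        (a.choose i' : ℝ) * (b.choose j' : ℝ) * ((-1) ^ j' + (-1) ^ i') *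
          (∫ v in Ioc (0 : ℝ) 1, Real.log v ^ (i' + j') * (v / (1 + v ^ 2) ^ 2)) *
          ((-1 / 2 : ℝ) ^ (a - i' + (b - j')) * Real.log (1 / y₂) ^ (a - i' + (b - j') + 1) /
            (((a - i' + (b - j') : ℕ) : ℝ) + 1))) := by
      simp only [hr]; ring
    rw [heq]
    have hy₁0 : 0 < y₁ := one_pos.trans_le hy₁
    have hnn : 0 ≤ (1 + Real.log y₂) ^ (a + b + 1) * (y₂ - y₁) / y₁ := by
      have : 0 ≤ Real.log y₂ := Real.log_nonneg (hy₁.trans h12)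
      apply div_nonneg (mul_nonneg (pow_nonneg (by linarith) _) (by linarith)) hy₁0.le
    calc _ ≤ C₄ * (1 + Real.log y₂) ^ (a + b + 1) * (y₂ - y₁) / y₁ := h
      _ = C₄ * ((1 + Real.log y₂) ^ (a + b + 1) * (y₂ - y₁) / y₁) := by ring
      _ ≤ C₀ * ((1 + Real.log y₂) ^ (a + b + 1) * (y₂ - y₁) / y₁) := mul_le_mul_of_nonneg_right h4 hnn
      _ = _ := by ring
  have hmain := abs_doubleSum_sqrt_log_weight_le (a := s) (r := r) (N := a + b + 1) hY hα hi hj hC₀0 hC₀0 hB hη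
    hS1 hS2 hT1 hT2 hY₁
  have hrw : ∀ k₁ k₂ : ℕ, r (α * k₁ * k₂) = ((∫ u₁ in Ioi (0 : ℝ), Real.log u₁ ^ a *
      ∫ u₂ in Ioi ((α * k₁ * k₂) / u₁), Real.exp (-(u₁ + u₂)) / (1 - Real.exp (-(u₁ + u₂))) ^ 2 *
        Real.log u₂ ^ b) -
    ((∫ u₁ in Ioi (0 : ℝ), Real.log u₁ ^ a *
        ∫ u₂ in Ioi (1 / u₁), Real.exp (-(u₁ + u₂)) / (1 - Real.exp (-(u₁ + u₂))) ^ 2 * Real.log u₂ ^ b) +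
      (∫ η in Ioc (0 : ℝ) 1, (η * (∫ u in Ioi (0 : ℝ), Real.log u ^ a * Real.log (η / u) ^ b *
          (Real.exp (-(u + η / u)) / (1 - Real.exp (-(u + η / u))) ^ 2) / u) -
        ∫ v in Ioc (0 : ℝ) 1, ((-(Real.log (1 / η) / 2) + Real.log v) ^ a *
            (-(Real.log (1 / η) / 2) - Real.log v) ^ b +
          (-(Real.log (1 / η) / 2) - Real.log v) ^ a * (-(Real.log (1 / η) / 2) + Real.log v) ^ b) *
          (v / (1 + v ^ 2) ^ 2)) / η) +
      ∑ i' ∈ Finset.range (a + 1), ∑ j' ∈ Finset.range (b + 1),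
        (a.choose i' : ℝ) * (b.choose j' : ℝ) * ((-1) ^ j' + (-1) ^ i') *
          (∫ v in Ioc (0 : ℝ) 1, Real.log v ^ (i' + j') * (v / (1 + v ^ 2) ^ 2)) *
          ((-1 / 2 : ℝ) ^ (a - i' + (b - j')) * Real.log (1 / (α * k₁ * k₂)) ^ (a - i' + (b - j') + 1) /
            (((a - i' + (b - j') : ℕ) : ℝ) + 1)))) := fun k₁ k₂ ↦ by simp only [hr]
  simp only [hrw] at hmain
  exact hmain

end Summit.Parity.GeneralizedHardyLittlewood.Theorems.MomentsBeyondDiagonal.DiagCorner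

end
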